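import Literature.Topology.FourManifolds.CappellShanesonClassNumberOne
import Mathlib.NumberTheory.NumberField.Ideal.KummerDedekind
import Mathlib.NumberTheory.NumberField.ClassNumber
import HarnessLib

/-!
# Class number one of the cubic fields of discriminant `257`, `697`, `1489`: the Aitchison–Rubinstein
# leaf of Gompf's Theorem 3.2 discharged

Fourth and last file of the number-theoretic side of the discharge of
`Literature.Barriers.SmoothPoincare4.gompf2010_theorem32_d` /
`Literature.Barriers.SmoothPoincare4.CappellShanesonSmallEntryBarrier`
(`CappellShanesonTraceClasses.lean` → `CappellShanesonClassNumbers.lean` →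
`CappellShanesonClassNumberOne.lean` → this file). It PROVES the named fact
`aitchisonRubinstein1984_classNumberOne_large` (Aitchison–Rubinstein, Contemp. Math. 35 (1984),
Appendix, Table 1, rows `a = 7, -2` (`Δ = 257`), `a = 8, -3` (`Δ = 697 = 17·41`), `a = 9, -4`
(`Δ = 1489`): `|C(R')| = 1`), and hence DISCHARGES

* `aitchisonRubinstein1984_classNumberOne_large_holds`,
* `aitchisonRubinstein1984_classNumberOne_holds` (`ℤ[X]/(f_a)` is a PID for every `a ∈ [-4, 9]`),
* `aitchisonRubinstein1984_uniqueTraceClass_holds` ("The class is unique when `-4 ≤ tr(A) ≤ 9`",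
  Gompf 2010, §3: any two Cappell–Shaneson matrices with the same trace in `[-4, 9]` are
  conjugate in `SL(3, ℤ)`).

After this file, of the five leaves of `cappellShanesonSmallEntryBarrier_of_leaves`
(`CappellShanesonFamilyStandardProofs.lean`) exactly the three topological ones
(`gompf2010_deltaMove`, `gompf2010_akbulutKirby_framings`, `akbulutKirby1979_sphere_four`) and the
trace `-5` class-number-two fact `aitchisonRubinstein1984_traceNegFiveClasses` remain.

## The proof (Marcus, *Number Fields*, Ch. 5, the computations after Thm. 37; Ch. 3, Thm. 27)

For a cubic number field `K` generated by a root `θ` of `f_a`, `a ∈ {-4, -3, -2, 7, 8, 9}`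
(`CappellShanesonClassNumberOne.lean` supplies `𝓞 K = ℤ[θ]`, `mem_adjoin_theta`, and
`d_K = Δ(f_a)`, `discr_eq_csDisc`):

* `thetaInt`, `adjoin_thetaInt_eq_top`, `exponent_thetaInt`: `θ ∈ 𝓞 K` generates `𝓞 K`, so
  Mathlib's Dedekind–Kummer theorem for number fields
  (`NumberField.Ideal.primesOverSpanEquivMonicFactorsMod`, exponent `1`) describes the primes
  above every `p`: `exists_factor_of_mem_primesOver` — a prime `P | p` is `(p, Q(θ))` for any lift
  `Q` of a monic irreducible factor `Q̄ | f_a mod p`, with residue degree `deg Q̄`;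
* `eq_span_of_no_root`: if `f_a` has no root mod `p` then `f_a mod p` is irreducible and
  `P = (p)` (inert, principal); `isPrincipal_of_unique_root`: if `f_a` has exactly one root `c₀`
  mod `p`, `p² > ⌊M_K⌋ ≥ p^{f_P}` and `(p, θ - c₀) = (α)` is certified by explicit cofactors
  (`span_pair_eq_span_singleton`), then `P` is principal;
* `floor_minkowskiBound_le_cubic`: `⌊M_K⌋ ≤ 4, 7, 10` for `|d_K| = 257, 697, 1489` (using only
  `r₂ ≤ 1` and `π > 3.14`, so the totally real signature is not needed);
* `isPrincipalIdealRing_ringOfIntegers_large`: Mathlib's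
  `RingOfIntegers.isPrincipalIdealRing_of_isPrincipal_of_pow_le_of_mem_primesOver_of_mem_Icc`
  with the finite data — `Δ = 257`: `2` inert, `3` has the single root `2`; `Δ = 697`: `2, 3, 7`
  inert, `5` has the single root `3` (`a = 8`) / `4` (`a = -3`); `Δ = 1489`: `2, 3, 5` inert
  (`P = (2)` is needed since `2³ ≤ 10`), `7` has the single root `4` (`a = 9`) / `6` (`a = -4`);
  the degree-one primes are generated by `2θ - 1` (`a > 0`; norm `11 - 2a = -3, -5, -7`) resp.
  `-θ - 1` (`a < 0`; norm `3, 5, 7`), e.g. for `a = 7`: `3 = (2θ - 1)(-11 + 26θ - 4θ²)`,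
  `θ - 2 = (2θ - 1)(6 - 13θ + 2θ²)`; all root counts are `decide`d in `ZMod p`.

## References

* [AitchisonRubinstein1984] I. R. Aitchison, J. H. Rubinstein, *Fibered knots and involutions on
  homotopy spheres*, Contemp. Math. 35 (1984) 1–74, Appendix "Conjugacy in `SL(3, ℤ)`", Table 1.
* [Marcus2018] D. A. Marcus, *Number Fields*, 2nd ed. (2018), Ch. 3, Thm. 27 (Dedekind–Kummer);
  Ch. 5, Cor. 2 of Thm. 37 and the discussion following it (class number computations).
* [GompfAGT2010] R. E. Gompf, Algebr. Geom. Topol. 10 (2010), §3.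
-/
noncomputable section

open Set Polynomial Module NumberField Ideal
open scoped NumberField

namespace Literature.Topology.FourManifolds

section Root

variable {K : Type*} [Field K] [NumberField K] {a : ℤ} {θ : K}

/-! ### `θ` as an algebraic integer; Dedekind's hypothesis `𝓞 K = ℤ[θ]` -/

/-- A root of `f_a`, as an element of `𝓞 K`. [folklore] -/
def thetaInt (hθ : aeval θ (csPoly a) = 0) : 𝓞 K := ⟨θ, isIntegral_of_aeval_csPoly hθ⟩

omit [NumberField K] in
/-- The underlying element of `thetaInt hθ` is `θ`. [folklore] -/
@[simp] theorem coe_thetaInt (hθ : aeval θ (csPoly a) = 0) : ((thetaInt hθ : 𝓞 K) : K) = θ := rfl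

/-- `thetaInt hθ` is a root of `f_a` in `𝓞 K`. [folklore] -/
theorem aeval_thetaInt (hθ : aeval θ (csPoly a) = 0) : aeval (thetaInt hθ) (csPoly a) = 0 := by
  apply IsFractionRing.injective (𝓞 K) K
  rw [map_zero, ← aeval_algebraMap_apply]
  exact hθ

/-- The cubic relation in `𝓞 K`. [folklore] -/
theorem thetaInt_rel (hθ : aeval θ (csPoly a) = 0) :
    (thetaInt hθ) ^ 3 - (a : 𝓞 K) * (thetaInt hθ) ^ 2 + ((a : 𝓞 K) - 1) * thetaInt hθ - 1 = 0 := by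
  have := aeval_thetaInt hθ
  simp only [csPoly, map_sub, map_add, map_mul, map_pow, aeval_X, map_one, eq_intCast,
    map_intCast] at this
  linear_combination this

/-- `minpoly_ℤ (thetaInt hθ) = f_a`. [cite: AitchisonRubinstein1984, Appendix, Lemma A4] -/
theorem minpoly_thetaInt (hθ : aeval θ (csPoly a) = 0) : minpoly ℤ (thetaInt hθ) = csPoly a := by
  rw [← minpoly.algebraMap_eq (IsFractionRing.injective (𝓞 K) K) (thetaInt hθ)]
  exact minpoly_int_eq hθ

/-- **`𝓞 K = ℤ[θ]` as a subalgebra statement**: for `-4 ≤ a ≤ 9`, `thetaInt hθ` generates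
`𝓞 K` as a `ℤ`-algebra (from `mem_adjoin_theta`). [cite: AitchisonRubinstein1984, Appendix, Table 1 (column R = R')] -/
theorem adjoin_thetaInt_eq_top (hθ : aeval θ (csPoly a) = 0) (h3 : finrank ℚ K = 3)
    (ha : a ∈ Icc (-4 : ℤ) 9) : Algebra.adjoin ℤ ({thetaInt hθ} : Set (𝓞 K)) = ⊤ := by
  refine Algebra.eq_top_iff.mpr fun x => ?_
  have hx := mem_adjoin_theta hθ h3 ha x
  let φ : 𝓞 K →ₐ[ℤ] K := (algebraMap (𝓞 K) K).toIntAlgHom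
  have hmap : Algebra.adjoin ℤ ({θ} : Set K) = (Algebra.adjoin ℤ ({thetaInt hθ} : Set (𝓞 K))).map φ := by
    rw [AlgHom.map_adjoin, Set.image_singleton]
    rfl
  rw [hmap, Subalgebra.mem_map] at hx
  obtain ⟨y, hy, hyx⟩ := hx
  have : y = x := IsFractionRing.injective (𝓞 K) K hyx
  rwa [← this]

/-- Hence Dedekind's criterion applies at every prime: the exponent of `thetaInt hθ` is `1`. [folklore] -/
theorem exponent_thetaInt (hθ : aeval θ (csPoly a) = 0) (h3 : finrank ℚ K = 3)
    (ha : a ∈ Icc (-4 : ℤ) 9) : RingOfIntegers.exponent (thetaInt hθ) = 1 :=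
  RingOfIntegers.exponent_eq_one_iff.mpr (adjoin_thetaInt_eq_top hθ h3 ha)

/-! ### Primes above `p` via Dedekind–Kummer -/

/-- `f_a` modulo `p`. [folklore] -/
def csPolyMod (a : ℤ) (p : ℕ) : (ZMod p)[X] := (csPoly a).map (Int.castRingHom (ZMod p))

omit [NumberField K] in
/-- `f_a mod p` is monic of degree `3`. [folklore] -/
theorem monic_csPolyMod (a : ℤ) (p : ℕ) [Fact p.Prime] : (csPolyMod a p).Monic :=
  (monic_csPoly a).map _

omit [NumberField K] in
/-- `f_a mod p` has degree `3`. [folklore] -/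
theorem natDegree_csPolyMod (a : ℤ) (p : ℕ) [Fact p.Prime] : (csPolyMod a p).natDegree = 3 := by
  rw [csPolyMod, (monic_csPoly a).natDegree_map, natDegree_csPoly]

omit [NumberField K] in
/-- Evaluation of `f_a mod p`. [folklore] -/
theorem eval_csPolyMod (a : ℤ) (p : ℕ) (c : ZMod p) :
    (csPolyMod a p).eval c = c ^ 3 - (a : ZMod p) * c ^ 2 + ((a : ZMod p) - 1) * c - 1 := by
  simp [csPolyMod, csPoly]

/-- **Dedekind–Kummer for `𝓞 K = ℤ[θ]`**: a prime `P` of `𝓞 K` above `p` is `(p, Q(θ))` for ANY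
integer lift `Q` of the corresponding monic irreducible factor `Q̄` of `f_a mod p`, with residue
degree `deg Q̄`; and `Q̄` is a monic irreducible divisor of `f_a mod p` (Mathlib's
`NumberField.Ideal.primesOverSpanEquivMonicFactorsMod`). [folklore] -/
theorem exists_factor_of_mem_primesOver (hθ : aeval θ (csPoly a) = 0) (h3 : finrank ℚ K = 3)
    (ha : a ∈ Icc (-4 : ℤ) 9) {p : ℕ} (hp : p.Prime) {P : Ideal (𝓞 K)}
    (hP : P ∈ primesOver (span {(p : ℤ)}) (𝓞 K)) :
    ∃ Qb : (ZMod p)[X], Irreducible Qb ∧ Qb.Monic ∧ Qb ∣ csPolyMod a p ∧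
      P.inertiaDeg ℤ = Qb.natDegree ∧
      ∀ Q : ℤ[X], Q.map (Int.castRingHom (ZMod p)) = Qb → P = span {(p : 𝓞 K), aeval (thetaInt hθ) Q} := by
  haveI := Fact.mk hp
  have hexp : ¬ p ∣ RingOfIntegers.exponent (thetaInt hθ) := by
    rw [exponent_thetaInt hθ h3 ha, Nat.dvd_one]
    exact hp.ne_one
  set e := NumberField.Ideal.primesOverSpanEquivMonicFactorsMod (K := K) hexp with he
  set Qb := e ⟨P, hP⟩ with hQb
  have hmem : (Qb : (ZMod p)[X]) ∈ RingOfIntegers.monicFactorsMod (thetaInt hθ) p := Qb.2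
  have hmem' := hmem
  simp only [RingOfIntegers.monicFactorsMod, Multiset.mem_toFinset, minpoly_thetaInt hθ] at hmem'
  have h0 : csPolyMod a p ≠ 0 := (monic_csPolyMod a p).ne_zero
  obtain ⟨hirr, hmon, hdvd⟩ := (Polynomial.mem_normalizedFactors_iff h0).mp hmem'
  refine ⟨Qb, hirr, hmon, hdvd, ?_, ?_⟩
  · have := NumberField.Ideal.inertiaDeg_primesOverSpanEquivMonicFactorsMod_symm_apply' hexp hmem
    rwa [show (⟨(Qb : (ZMod p)[X]), hmem⟩ : RingOfIntegers.monicFactorsMod (thetaInt hθ) p) = Qb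
      from Subtype.ext rfl, Equiv.symm_apply_apply] at this
  · intro Q hQ
    have hmemQ : Q.map (Int.castRingHom (ZMod p)) ∈ RingOfIntegers.monicFactorsMod (thetaInt hθ) p := hQ ▸ hmem
    have h1 := NumberField.Ideal.primesOverSpanEquivMonicFactorsMod_symm_apply_eq_span hexp hmemQ
    have h2 : (⟨Q.map (Int.castRingHom (ZMod p)), hmemQ⟩ :
        RingOfIntegers.monicFactorsMod (thetaInt hθ) p) = Qb := Subtype.ext hQ
    rw [h2, hQb, Equiv.symm_apply_apply] at h1
    exact h1

/-- **Inert primes are principal**: if `f_a` has no root modulo `p` (so that `f_a mod p`, a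
cubic, is irreducible), every prime of `𝓞 K` above `p` is `(p)`. [folklore] -/
theorem eq_span_of_no_root (hθ : aeval θ (csPoly a) = 0) (h3 : finrank ℚ K = 3)
    (ha : a ∈ Icc (-4 : ℤ) 9) {p : ℕ} (hp : p.Prime)
    {P : Ideal (𝓞 K)} (hP : P ∈ primesOver (span {(p : ℤ)}) (𝓞 K))
    (hnr : ∀ c : ZMod p, c ^ 3 - (a : ZMod p) * c ^ 2 + ((a : ZMod p) - 1) * c - 1 ≠ 0) :
    P = span {(p : 𝓞 K)} := by
  haveI := Fact.mk hp
  obtain ⟨Qb, hirr, hmon, hdvd, -, hspan⟩ := exists_factor_of_mem_primesOver hθ h3 ha hp hP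
  have hfirr : Irreducible (csPolyMod a p) := by
    refine irreducible_of_degree_le_three_of_not_isRoot
      (by rw [natDegree_csPolyMod]; decide) fun c hc => hnr c ?_
    rwa [IsRoot.def, eval_csPolyMod] at hc
  have hQb : Qb = csPolyMod a p :=
    eq_of_monic_of_associated hmon (monic_csPolyMod a p) (hirr.associated_of_dvd hfirr hdvd)
  have h := hspan (csPoly a) (by rw [hQb]; rfl)
  rw [aeval_thetaInt hθ] at h
  rw [h, Ideal.span_insert, Ideal.span_singleton_eq_bot.mpr rfl, sup_bot_eq]

/-- **Split primes with a certified generator are principal.** Suppose `f_a` has exactly one root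
`c₀` modulo `p`, `p² > U ≥ p ^ f_P` (so only residue degree one matters), and `α ∈ 𝓞 K`
generates `(p, θ - c₀)`. Then a prime `P` above `p` with `p ^ f_P ≤ U` is principal: its
Dedekind–Kummer factor is linear, hence `X - c₀`, and `P = (p, θ - c₀) = (α)`. [folklore] -/
theorem isPrincipal_of_unique_root (hθ : aeval θ (csPoly a) = 0) (h3 : finrank ℚ K = 3)
    (ha : a ∈ Icc (-4 : ℤ) 9) {p : ℕ} (hp : p.Prime) {P : Ideal (𝓞 K)}
    (hP : P ∈ primesOver (span {(p : ℤ)}) (𝓞 K)) {U : ℕ} (hle : p ^ P.inertiaDeg ℤ ≤ U)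
    {c₀ : ℤ}
    (hroot : ∀ c : ZMod p, c ^ 3 - (a : ZMod p) * c ^ 2 + ((a : ZMod p) - 1) * c - 1 = 0 →
      c = (c₀ : ZMod p))
    (hU : U < p ^ 2) {α : 𝓞 K}
    (hα : span {(p : 𝓞 K), thetaInt hθ - (c₀ : 𝓞 K)} = span {α}) :
    Submodule.IsPrincipal P := by
  haveI := Fact.mk hp
  obtain ⟨Qb, hirr, hmon, hdvd, hdeg, hspan⟩ := exists_factor_of_mem_primesOver hθ h3 ha hp hP
  have hQb1 : Qb.natDegree = 1 := by
    have h1 : 1 ≤ Qb.natDegree := by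
      rcases Nat.eq_zero_or_pos Qb.natDegree with h0 | h0
      · exact absurd (Polynomial.eq_one_of_monic_natDegree_zero hmon h0 ▸ isUnit_one)
          hirr.not_isUnit
      · exact h0
    by_contra hne
    have h2 : 2 ≤ Qb.natDegree := by omega
    have : p ^ 2 ≤ p ^ P.inertiaDeg ℤ := Nat.pow_le_pow_right hp.pos (hdeg ▸ h2)
    omega
  -- the linear factor is `X - c₀`
  have hQbeq : Qb = X + C (Qb.coeff 0) := hmon.eq_X_add_C hQb1
  have hc : -Qb.coeff 0 = (c₀ : ZMod p) := by
    apply hroot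
    have hr : (csPolyMod a p).IsRoot (-Qb.coeff 0) := by
      rw [← dvd_iff_isRoot, map_neg, sub_neg_eq_add, ← hQbeq]
      exact hdvd
    rwa [IsRoot.def, eval_csPolyMod] at hr
  have hQb' : (X - C c₀ : ℤ[X]).map (Int.castRingHom (ZMod p)) = Qb := by
    rw [Polynomial.map_sub, map_X, map_C, eq_intCast, ← hc, map_neg, sub_neg_eq_add, ← hQbeq]
  have hPeq := hspan (X - C c₀) hQb'
  simp only [map_sub, aeval_X, aeval_C, algebraMap_int_eq, Int.coe_castRingHom] at hPeq
  rw [hα] at hPeq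
  exact ⟨⟨α, by rw [hPeq, Ideal.submodule_span_eq]⟩⟩

/-- **Certificate for `(p, θ - c) = (α)`**: it suffices to write `α = u p + v (θ - c)` and
`p = α δ`, `θ - c = α ε` in `𝓞 K`. [folklore] -/
theorem span_pair_eq_span_singleton {R : Type*} [CommRing R] {p t α u v δ ε : R}
    (h1 : α = u * p + v * t) (h2 : p = α * δ) (h3 : t = α * ε) :
    span {p, t} = span ({α} : Set R) := by
  apply le_antisymm
  · rw [Ideal.span_le]
    rintro x hx
    simp only [Set.mem_insert_iff, Set.mem_singleton_iff] at hx
    rcases hx with rfl | rfl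
    · exact Ideal.mem_span_singleton'.mpr ⟨δ, by rw [mul_comm]; exact h2.symm⟩
    · exact Ideal.mem_span_singleton'.mpr ⟨ε, by rw [mul_comm]; exact h3.symm⟩
  · rw [Ideal.span_singleton_le_iff_mem, Ideal.mem_span_pair]
    exact ⟨u, v, h1.symm⟩

/-! ### The Minkowski bound for a cubic field -/

/-- **`⌊M_K⌋ ≤ U` for a cubic field**: if `|d_K| ≤ D ≤ s²` and `(4/3.14) · (6/27) · s < U + 1`,
then the Minkowski constant `M_K = (4/π)^{r₂} (3!/3³) √|d_K|` has `⌊M_K⌋ ≤ U`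
(`r₂ ≤ 1`, `π > 3.14`). Marcus, *Number Fields*, Ch. 5, Cor. 2 of Thm. 37. [folklore] -/
theorem floor_minkowskiBound_le_cubic (h3 : finrank ℚ K = 3) {D : ℕ} {s : ℝ} {U : ℕ}
    (hD : ((|NumberField.discr K| : ℤ) : ℝ) ≤ D) (hs : (D : ℝ) ≤ s ^ 2) (hs0 : 0 ≤ s)
    (hU : 4 / 3.14 * (6 / (3 : ℝ) ^ 3 * s) < U + 1) :
    ⌊(4 / Real.pi) ^ NumberField.InfinitePlace.nrComplexPlaces K *
        ((finrank ℚ K).factorial / (finrank ℚ K : ℝ) ^ finrank ℚ K *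
          Real.sqrt |(NumberField.discr K : ℝ)|)⌋₊ ≤ U := by
  have hc : NumberField.InfinitePlace.nrComplexPlaces K ≤ 1 := by
    have := NumberField.InfinitePlace.card_add_two_mul_card_eq_rank K
    rw [h3] at this
    omega
  have hπ : (3.14 : ℝ) < Real.pi := Real.pi_gt_d2
  have hπ0 : 0 < Real.pi := Real.pi_pos
  have hD' : |(NumberField.discr K : ℝ)| ≤ D := by
    rw [← Int.cast_abs]
    exact hD
  have hsqrt : Real.sqrt |(NumberField.discr K : ℝ)| ≤ s := by
    rw [Real.sqrt_le_iff]
    exact ⟨hs0, hD'.trans hs⟩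
  rw [h3]
  have hfac : ((3 : ℕ).factorial : ℝ) = 6 := by norm_num [Nat.factorial]
  rw [hfac]
  have hpow : (4 / Real.pi) ^ NumberField.InfinitePlace.nrComplexPlaces K ≤ 4 / 3.14 := by
    rcases Nat.le_one_iff_eq_zero_or_eq_one.mp hc with h | h <;> rw [h]
    · norm_num
    · rw [pow_one]
      exact (div_lt_div_of_pos_left (by norm_num) (by norm_num) hπ).le
  refine Nat.le_of_lt_succ ((Nat.floor_lt (by positivity)).mpr ?_)
  push_cast
  calc (4 / Real.pi) ^ NumberField.InfinitePlace.nrComplexPlaces K *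
        (6 / (3 : ℝ) ^ 3 * Real.sqrt |(NumberField.discr K : ℝ)|)
      ≤ 4 / 3.14 * (6 / (3 : ℝ) ^ 3 * s) :=
        mul_le_mul hpow (by gcongr) (by positivity) (by positivity)
    _ < U + 1 := hU

/-! ### The three fields: `Δ = 257` (`a = 7, -2`), `Δ = 697` (`a = 8, -3`), `Δ = 1489` (`a = 9, -4`) -/

/-- **Class number one for `a ∈ {-4, -3, -2, 7, 8, 9}` (proved).** The ring of integers of a cubic
field generated by a root of `f_a` is principal (Aitchison–Rubinstein, Table 1, rows `a = 7, -2`,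
`a = 8, -3`, `a = 9, -4`: `|C(R')| = 1`). Proof (Marcus, Ch. 5, after Thm. 37): `𝓞 K = ℤ[θ]` and
`d_K = Δ(f_a)`; the Minkowski bound is `⌊M_K⌋ ≤ 4, 7, 10` respectively (`r₂ ≤ 1`, `π > 3.14`);
`f_a` is irreducible modulo every prime `p ≤ ⌊M_K⌋` (which are then inert, `P = (p)`) except
`p = 3, 5, 7` respectively, where it has exactly one root `c₀` and the degree-one prime
`(p, θ - c₀)` is generated by `2θ - 1` (`a > 0`, norm `11 - 2a = -3, -5, -7`) resp. `-θ - 1`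
(`a < 0`, norm `3, 5, 7`), with explicit cofactors; degree-two primes have `p² > ⌊M_K⌋`. [cite: AitchisonRubinstein1984, Appendix, Table 1 (rows a = 7,-2; 8,-3; 9,-4)] -/
theorem isPrincipalIdealRing_ringOfIntegers_large (hθ : aeval θ (csPoly a) = 0)
    (h3 : finrank ℚ K = 3) (ha : a ∈ ({-4, -3, -2, 7, 8, 9} : Finset ℤ)) :
    IsPrincipalIdealRing (𝓞 K) := by
  have ha' : a ∈ Icc (-4 : ℤ) 9 := by
    simp only [Finset.mem_insert, Finset.mem_singleton] at ha
    simp only [mem_Icc]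
    omega
  have hdisc := discr_eq_csDisc hθ h3 ha'
  have rel := thetaInt_rel hθ
  set t := thetaInt hθ with ht
  simp only [Finset.mem_insert, Finset.mem_singleton] at ha
  rcases ha with rfl | rfl | rfl | rfl | rfl | rfl
  · -- `a = -4`, `Δ = 1489`, `⌊M_K⌋ ≤ 10`; `7` splits with root `6`, generator `-θ - 1`
    have rel' : t ^ 3 + 4 * t ^ 2 - 5 * t - 1 = 0 := by push_cast at rel; linear_combination rel
    have hd : ((|NumberField.discr K| : ℤ) : ℝ) ≤ (1489 : ℕ) := by
      rw [hdisc]; norm_num [csDisc]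
    have hfloor := floor_minkowskiBound_le_cubic h3 hd (s := 38.6) (U := 10) (by norm_num)
      (by norm_num) (by norm_num)
    refine RingOfIntegers.isPrincipalIdealRing_of_isPrincipal_of_pow_le_of_mem_primesOver_of_mem_Icc
      fun p hp hprime P hP hle => ?_
    have hpU : p ≤ 10 := (Finset.mem_Icc.mp hp).2.trans hfloor
    have hle' : p ^ P.inertiaDeg ℤ ≤ 10 := hle.trans hfloor
    have h1p : 1 ≤ p := (Finset.mem_Icc.mp hp).1
    interval_cases p <;> first
      | (exfalso; revert hprime; decide)
      | exact ⟨⟨_, by rw [eq_span_of_no_root hθ h3 ha' hprime hP (by decide), submodule_span_eq]⟩⟩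
      | -- `p = 7`: the split prime
        exact isPrincipal_of_unique_root hθ h3 ha' hprime hP hle' (c₀ := 6) (by decide) (by norm_num)
          (α := -t - 1) (span_pair_eq_span_singleton (u := -1) (v := -1) (δ := -8 + 3 * t + t ^ 2)
            (ε := 7 - 3 * t - t ^ 2) (by push_cast; ring) (by push_cast; linear_combination rel')
            (by push_cast; linear_combination (-1 : 𝓞 K) * rel'))
  · -- `a = -3`, `Δ = 697`, `⌊M_K⌋ ≤ 7`; `5` splits with root `4`, generator `-θ - 1`
    have rel' : t ^ 3 + 3 * t ^ 2 - 4 * t - 1 = 0 := by push_cast at rel; linear_combination rel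
    have hd : ((|NumberField.discr K| : ℤ) : ℝ) ≤ (697 : ℕ) := by
      rw [hdisc]; norm_num [csDisc]
    have hfloor := floor_minkowskiBound_le_cubic h3 hd (s := 26.41) (U := 7) (by norm_num)
      (by norm_num) (by norm_num)
    refine RingOfIntegers.isPrincipalIdealRing_of_isPrincipal_of_pow_le_of_mem_primesOver_of_mem_Icc
      fun p hp hprime P hP hle => ?_
    have hpU : p ≤ 7 := (Finset.mem_Icc.mp hp).2.trans hfloor
    have hle' : p ^ P.inertiaDeg ℤ ≤ 7 := hle.trans hfloor
    have h1p : 1 ≤ p := (Finset.mem_Icc.mp hp).1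
    interval_cases p <;> first
      | (exfalso; revert hprime; decide)
      | exact ⟨⟨_, by rw [eq_span_of_no_root hθ h3 ha' hprime hP (by decide), submodule_span_eq]⟩⟩
      | -- `p = 5`: the split prime
        exact isPrincipal_of_unique_root hθ h3 ha' hprime hP hle' (c₀ := 4) (by decide) (by norm_num)
          (α := -t - 1) (span_pair_eq_span_singleton (u := -1) (v := -1) (δ := -6 + 2 * t + t ^ 2)
            (ε := 5 - 2 * t - t ^ 2) (by push_cast; ring) (by push_cast; linear_combination rel')
            (by push_cast; linear_combination (-1 : 𝓞 K) * rel'))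
  · -- `a = -2`, `Δ = 257`, `⌊M_K⌋ ≤ 4`; `3` splits with root `2`, generator `-θ - 1`
    have rel' : t ^ 3 + 2 * t ^ 2 - 3 * t - 1 = 0 := by push_cast at rel; linear_combination rel
    have hd : ((|NumberField.discr K| : ℤ) : ℝ) ≤ (257 : ℕ) := by
      rw [hdisc]; norm_num [csDisc]
    have hfloor := floor_minkowskiBound_le_cubic h3 hd (s := 16.04) (U := 4) (by norm_num)
      (by norm_num) (by norm_num)
    refine RingOfIntegers.isPrincipalIdealRing_of_isPrincipal_of_pow_le_of_mem_primesOver_of_mem_Icc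
      fun p hp hprime P hP hle => ?_
    have hpU : p ≤ 4 := (Finset.mem_Icc.mp hp).2.trans hfloor
    have hle' : p ^ P.inertiaDeg ℤ ≤ 4 := hle.trans hfloor
    have h1p : 1 ≤ p := (Finset.mem_Icc.mp hp).1
    interval_cases p <;> first
      | (exfalso; revert hprime; decide)
      | exact ⟨⟨_, by rw [eq_span_of_no_root hθ h3 ha' hprime hP (by decide), submodule_span_eq]⟩⟩
      | -- `p = 3`: the split prime
        exact isPrincipal_of_unique_root hθ h3 ha' hprime hP hle' (c₀ := 2) (by decide) (by norm_num)
          (α := -t - 1) (span_pair_eq_span_singleton (u := -1) (v := -1) (δ := -4 + t + t ^ 2)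
            (ε := 3 - t - t ^ 2) (by push_cast; ring) (by push_cast; linear_combination rel')
            (by push_cast; linear_combination (-1 : 𝓞 K) * rel'))
  · -- `a = 7`, `Δ = 257`, `⌊M_K⌋ ≤ 4`; `3` splits with root `2`, generator `2θ - 1`
    have rel' : t ^ 3 - 7 * t ^ 2 + 6 * t - 1 = 0 := by push_cast at rel; linear_combination rel
    have hd : ((|NumberField.discr K| : ℤ) : ℝ) ≤ (257 : ℕ) := by
      rw [hdisc]; norm_num [csDisc]
    have hfloor := floor_minkowskiBound_le_cubic h3 hd (s := 16.04) (U := 4) (by norm_num)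
      (by norm_num) (by norm_num)
    refine RingOfIntegers.isPrincipalIdealRing_of_isPrincipal_of_pow_le_of_mem_primesOver_of_mem_Icc
      fun p hp hprime P hP hle => ?_
    have hpU : p ≤ 4 := (Finset.mem_Icc.mp hp).2.trans hfloor
    have hle' : p ^ P.inertiaDeg ℤ ≤ 4 := hle.trans hfloor
    have h1p : 1 ≤ p := (Finset.mem_Icc.mp hp).1
    interval_cases p <;> first
      | (exfalso; revert hprime; decide)
      | exact ⟨⟨_, by rw [eq_span_of_no_root hθ h3 ha' hprime hP (by decide), submodule_span_eq]⟩⟩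
      | -- `p = 3`: the split prime
        exact isPrincipal_of_unique_root hθ h3 ha' hprime hP hle' (c₀ := 2) (by decide) (by norm_num)
          (α := 2 * t - 1) (span_pair_eq_span_singleton (u := 1) (v := 2) (δ := -11 + 26 * t - 4 * t ^ 2)
            (ε := 6 - 13 * t + 2 * t ^ 2) (by push_cast; ring) (by push_cast; linear_combination (8 : 𝓞 K) * rel')
            (by push_cast; linear_combination (-4 : 𝓞 K) * rel'))
  · -- `a = 8`, `Δ = 697`, `⌊M_K⌋ ≤ 7`; `5` splits with root `3`, generator `2θ - 1`
    have rel' : t ^ 3 - 8 * t ^ 2 + 7 * t - 1 = 0 := by push_cast at rel; linear_combination rel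
    have hd : ((|NumberField.discr K| : ℤ) : ℝ) ≤ (697 : ℕ) := by
      rw [hdisc]; norm_num [csDisc]
    have hfloor := floor_minkowskiBound_le_cubic h3 hd (s := 26.41) (U := 7) (by norm_num)
      (by norm_num) (by norm_num)
    refine RingOfIntegers.isPrincipalIdealRing_of_isPrincipal_of_pow_le_of_mem_primesOver_of_mem_Icc
      fun p hp hprime P hP hle => ?_
    have hpU : p ≤ 7 := (Finset.mem_Icc.mp hp).2.trans hfloor
    have hle' : p ^ P.inertiaDeg ℤ ≤ 7 := hle.trans hfloor
    have h1p : 1 ≤ p := (Finset.mem_Icc.mp hp).1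
    interval_cases p <;> first
      | (exfalso; revert hprime; decide)
      | exact ⟨⟨_, by rw [eq_span_of_no_root hθ h3 ha' hprime hP (by decide), submodule_span_eq]⟩⟩
      | -- `p = 5`: the split prime
        exact isPrincipal_of_unique_root hθ h3 ha' hprime hP hle' (c₀ := 3) (by decide) (by norm_num)
          (α := 2 * t - 1) (span_pair_eq_span_singleton (u := 1) (v := 2) (δ := -13 + 30 * t - 4 * t ^ 2)
            (ε := 7 - 15 * t + 2 * t ^ 2) (by push_cast; ring) (by push_cast; linear_combination (8 : 𝓞 K) * rel')
            (by push_cast; linear_combination (-4 : 𝓞 K) * rel'))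
  · -- `a = 9`, `Δ = 1489`, `⌊M_K⌋ ≤ 10`; `2` is inert (`P = (2)`), `7` splits with root `4`
    have rel' : t ^ 3 - 9 * t ^ 2 + 8 * t - 1 = 0 := by push_cast at rel; linear_combination rel
    have hd : ((|NumberField.discr K| : ℤ) : ℝ) ≤ (1489 : ℕ) := by
      rw [hdisc]; norm_num [csDisc]
    have hfloor := floor_minkowskiBound_le_cubic h3 hd (s := 38.6) (U := 10) (by norm_num)
      (by norm_num) (by norm_num)
    refine RingOfIntegers.isPrincipalIdealRing_of_isPrincipal_of_pow_le_of_mem_primesOver_of_mem_Icc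
      fun p hp hprime P hP hle => ?_
    have hpU : p ≤ 10 := (Finset.mem_Icc.mp hp).2.trans hfloor
    have hle' : p ^ P.inertiaDeg ℤ ≤ 10 := hle.trans hfloor
    have h1p : 1 ≤ p := (Finset.mem_Icc.mp hp).1
    interval_cases p <;> first
      | (exfalso; revert hprime; decide)
      | exact ⟨⟨_, by rw [eq_span_of_no_root hθ h3 ha' hprime hP (by decide), submodule_span_eq]⟩⟩
      | -- `p = 7`: the split prime
        exact isPrincipal_of_unique_root hθ h3 ha' hprime hP hle' (c₀ := 4) (by decide) (by norm_num)
          (α := 2 * t - 1) (span_pair_eq_span_singleton (u := 1) (v := 2) (δ := -15 + 34 * t - 4 * t ^ 2)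
            (ε := 8 - 17 * t + 2 * t ^ 2) (by push_cast; ring) (by push_cast; linear_combination (8 : 𝓞 K) * rel')
            (by push_cast; linear_combination (-4 : 𝓞 K) * rel'))

end Root

/-! ### Discharge of the named facts -/

/-- **Aitchison–Rubinstein 1984, Table 1, rows `Δ = 257, 697, 1489`: class number one — the
named fact `aitchisonRubinstein1984_classNumberOne_large` DISCHARGED.** [cite: AitchisonRubinstein1984, Appendix, Table 1 (rows a = 7,-2; 8,-3; 9,-4)] -/
theorem aitchisonRubinstein1984_classNumberOne_large_holds :
    aitchisonRubinstein1984_classNumberOne_large := by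
  intro a ha K _ _ θ hθ h3
  exact isPrincipalIdealRing_ringOfIntegers_large hθ h3 ha

/-- **Table 1 for `-4 ≤ a ≤ 9` — the named fact `aitchisonRubinstein1984_classNumberOne`
DISCHARGED**: `ℤ[X]/(f_a)` is a principal ideal domain for every `a ∈ [-4, 9]`. [cite: AitchisonRubinstein1984, Appendix, Table 1] -/
theorem aitchisonRubinstein1984_classNumberOne_holds : aitchisonRubinstein1984_classNumberOne :=
  aitchisonRubinstein1984_classNumberOne_of_large aitchisonRubinstein1984_classNumberOne_large_holds

/-- **"The class is unique when `-4 ≤ tr(A) ≤ 9`" — the named fact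
`aitchisonRubinstein1984_uniqueTraceClass` DISCHARGED**: any two Cappell–Shaneson matrices
(`det (A - I) = 1`) with the same trace in `[-4, 9]` are conjugate in `SL(3, ℤ)`
(Latimer–MacDuffee–Taussky and Table 1). [cite: GompfAGT2010, §3] [cite: AitchisonRubinstein1984, Appendix (Conjugacy in SL(3,Z)), Table 1] -/
theorem aitchisonRubinstein1984_uniqueTraceClass_holds : aitchisonRubinstein1984_uniqueTraceClass :=
  aitchisonRubinstein1984_uniqueTraceClass_of_large aitchisonRubinstein1984_classNumberOne_large_holds

end Literature.Topology.FourManifolds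

end
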